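import Summits.ABC.IUTFork.LDHInitialThetaDataPerPrime
import HarnessLib

/-!
# The fork at [IUTchIII] Corollary 3.12, L-DH level: R0 FAILS AT THE PACKET `(j, p)` for the genuine Θ-volume input OF
# INITIAL Θ-DATA — every degree `j ≥ 2`, threshold in `p, l, j, [K:ℚ], [F_mod:ℚ], ord(q)` only

Record-only file (D-0012) of the abc-iut cell (WAVE-5 prover abc-iut-w5-d157, gen 3); PROOF-ONLY, no definition, no
`Prop` fact; TAKES NO SIDE on Cor. 3.12. Sequel to `LDHInitialThetaDataPerPrime.lean` (p424677/p425267, the PER-PRIME form)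
and to this seat's `LDHPerPacketReading.lean` (p417638, `DHData.not_perPacketReading_of_deep`: at ONE tensor degree `j = i+1`
over a prime `p` with ONE place `v₀` of `F₀` over it, the per-PACKET reading R0 "`ln ν̄_{𝔸_p^{⊗ j+1}}(O_𝕃(−P_q)) ≤
ln ν̄_{𝔸_p^{⊗ j+1}}(hull U_Θ)`" — skeleton XXIV's `Cor312Vol.perPlace_bound_of_pointwise` reading at `(j, v_ℚ = p)`,
STRONGER than the printed GLOBAL inequality — FAILS once `((j+1)·d(K_{v̲₀}) + 1)·log p + (j+1)·(3 + log e(K_{v̲₀})) <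
(j² − 1)·P_q(v₀)·ln N(v₀)/[F₀:ℚ]`).  HOME/plan/ADJUDICATION-SPEC.md §2 (G1′) words the hedge per packet:
«(j²−1)·ord(q̲_v) ≤ c′ fails for j ≥ 2 at a high-valuation q-parameter».  Here that sentence is kernel-checked AT INITIAL
Θ-DATA, for EVERY degree `2 ≤ j ≤ ℓ⋆`, with the local invariants of `K_{v̲₀}` replaced by `[K:ℚ]`:

* §1 `ThetaVolumeInput.stepVConst_lt_of_finrank'` — the `ord(q)`-free Step (v) constant with ANY coefficient `c > 0`
  (`c = j+1` per packet, `c = (ℓ⋆+3)/2` per prime): `(c·d + 1)·log p + c·(3 + log e) < c·(log p + 2·log[K:ℚ] + 3) + log p`;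
  `…not_perPacketReading_of_ordq_large_finrank` — any genuine input, ONE place `v₀ ∈ S` over `p`, degree `j = i+1`:
  `(j+1)·(log p + 2·log[K:ℚ] + 3) + log p ≤ (j² − 1)·(ord_{v₀}(q)/(2l))·log p/[F₀:ℚ]` ⟹ R0 false at `(j, p)` for
  `DHData.ofInput I` (so: depth LINEAR in `l/(j−1)` at low degrees, `l`-FREE at the top degree `j = ℓ⋆`);
  `…not_perPacketReading_top_of_ordq_log_ge` — the TOP degree `j = ℓ⋆` (skeleton §3's instance) with clean constants:
  `10·(log p + 2·log[K:ℚ] + 3) + 4·log p ≤ ord_{v₀}(q)·log p/[F₀:ℚ]` (good for every `l ≥ 5`; `(ℓ⋆−2)(ℓ⋆+1) ≥ 0`,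
  `4ℓ⋆² − 4ℓ⋆ − 6 ≥ 0`).
* §2 INITIAL Θ-DATA (`D : InitialThetaData F K F̄ E l Pb`, abc-iut-S2's `volumeInputOf D r`): the three forms above at
  `I := volumeInputOf D r`, and the `j_E ∈ ℚ` form: ONE bad prime `p` with `ord_p(q)·log p ≥ 14·log p + 20·log[K:ℚ] + 30`
  kills R0 (hence R2/R3/R4/VolumeTransport, skeleton XXIV) at the top packet `(ℓ⋆, p)`, EVERY idele datum `r`.

HONEST SCOPE as in the per-prime file: universally quantified over initial Θ-data and idele data, NO initial Θ-data constructed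
or claimed to exist; ONE place of `F_mod` over `p`; per-packet readings only (STRONGER-THAN-PRINT); nothing about the printed
GLOBAL inequality, `Cor312Of`, or the verbatim `Cor312.Setting`. [cite: Mochizuki2012, IUTchI Def. 3.1 p. 61–62]
[cite: Mochizuki2012, IUTchIV Thm. 1.10 Step (v) p. 27–28] [cite: DupuyHilado2025, Def. 3.6.3, Thm. 3.10.1]
[claim: Mochizuki2012, status: disputed] for every IUT quotation. typed ≠ proved; instantiated ≠ endorsed.
-/

noncomputable section

open NumberField IsDedekindDomain
open Literature.IUT.LogVolume Literature.IUT.HodgeTheaters Literature.NumberTheory.NumberFields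

namespace Summit.ABC.IUTFork

/-! ## §1 Any genuine input: R0 at the packet `(j, p)` against `[K:ℚ]` -/

namespace ThetaVolumeInput

variable {F₀ K : Type} [Field F₀] [NumberField F₀] [Field K] [NumberField K] [Algebra F₀ K]

/-- **The `ord(q)`-free Step (v) constant with an arbitrary coefficient `c > 0`** (any genuine input, any place `v₀` over
`p`): `(c·d(K_{v̲₀}) + 1)·log p + c·(3 + log e(K_{v̲₀})) < c·(log p + 2·log[K:ℚ] + 3) + log p`.
[cite: Mochizuki2012, IUTchIV Thm. 1.10 Step (v) p. 27–28] [cite: SerreLocalFields1979, Ch. III §6 Prop. 13] -/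
theorem stepVConst_lt_of_finrank' (I : Literature.IUT.LogVolume.ThetaVolumeInput F₀ K) {p : ℕ} [hpi : Fact p.Prime]
    (v₀ : placesOver F₀ p) {c : ℝ} (hc : 0 < c) :
    (c * differentOrd p ((I.σ.localFieldFamily p hpi.out).k v₀) + 1) * Real.log p
        + c * (3 + Real.log (absRamificationIdx p ((I.σ.localFieldFamily p hpi.out).k v₀))) <
      c * (Real.log p + 2 * Real.log (Module.finrank ℚ K) + 3) + Real.log p := by
  set d : ℝ := differentOrd p ((I.σ.localFieldFamily p hpi.out).k v₀) with hd
  set e : ℕ := absRamificationIdx p ((I.σ.localFieldFamily p hpi.out).k v₀) with he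
  set n : ℕ := localDeg K (I.σ.lift v₀.1) with hn
  set N : ℕ := Module.finrank ℚ K with hN
  have hp1 : (1 : ℝ) < p := by exact_mod_cast hpi.out.one_lt
  have hlogp : 0 < Real.log p := Real.log_pos hp1
  have hn0 : n ≠ 0 := by
    rw [hn, localDeg_eq_localDegree]
    exact (localDegree_pos K _).ne'
  have hnN : n ≤ N := localDeg_lift_le_finrank I.σ v₀
  have hlogn : Real.log n ≤ Real.log N :=
    Real.log_le_log (by exact_mod_cast Nat.pos_of_ne_zero hn0) (by exact_mod_cast hnN)
  have hdlt : d < 1 + padicValNat p n := differentOrd_localFieldFamily_lt I.σ v₀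
  have hv : (padicValNat p n : ℝ) * Real.log p ≤ Real.log N := (padicValNat_mul_log_le p hn0).trans hlogn
  have hdlog : d * Real.log p < Real.log p + Real.log N := by
    have := mul_lt_mul_of_pos_right hdlt hlogp
    linarith [this]
  have he1 : 1 ≤ e := absRamificationIdx_pos p _
  have heN : e ≤ N := absRamificationIdx_localFieldFamily_le_finrank I.σ v₀
  have hloge : Real.log e ≤ Real.log N := Real.log_le_log (by exact_mod_cast he1) (by exact_mod_cast heN)
  have h1 : (c * d + 1) * Real.log p < c * (Real.log p + Real.log N) + Real.log p := by
    have := mul_lt_mul_of_pos_left hdlog hc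
    nlinarith [this]
  have h2 : c * (3 + Real.log e) ≤ c * (3 + Real.log N) := by gcongr
  linarith [h1, h2]

/-- **R0 FAILS AT THE PACKET `(j, p)` — threshold in `p, l, j, [K:ℚ], [F₀:ℚ], ord_{v₀}(q)` only** (any genuine input, ONE
place `v₀ ∈ S` of `F₀` over `p`, degree `j = i+1`): `(j+1)·(log p + 2·log[K:ℚ] + 3) + log p ≤
(j² − 1)·(ord_{v₀}(q)/(2l))·log p/[F₀:ℚ]` gives `¬ (ln ν̄_{𝔸_p^{⊗ j+1}}(O_𝕃(−P_q)) ≤ ln ν̄_{𝔸_p^{⊗ j+1}}(hull U_Θ))` for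
`DHData.ofInput I`. [cite: Mochizuki2012, IUTchIV Thm. 1.10 Step (v) p. 27–28] [cite: DupuyHilado2025, Def. 3.6.3, Thm. 3.10.1]
[claim: Mochizuki2012, status: disputed] -/
theorem not_perPacketReading_of_ordq_large_finrank (I : Literature.IUT.LogVolume.ThetaVolumeInput F₀ K) {p : ℕ}
    [hpi : Fact p.Prime] (hp1 : ∀ v w : placesOver F₀ p, v = w) (v₀ : placesOver F₀ p) (hv₀ : v₀.1 ∈ I.X.S)
    (i : Fin I.X.lstar)
    (hdeep : (((i : ℕ) : ℝ) + 2) * (Real.log p + 2 * Real.log (Module.finrank ℚ K) + 3) + Real.log p ≤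
      ((((i : ℕ) + 1 : ℝ) ^ 2) - 1) * ((I.X.ordq v₀.1 : ℝ) / (2 * I.X.l) * Real.log p / Module.finrank ℚ F₀)) :
    ¬ (DHData.ofInput I).M.lnνTensorPower p ((i : ℕ) + 1) ((DHData.ofInput I).M.region (DHData.ofInput I).tq) ≤
      (DHData.ofInput I).M.lnνTensorPower p ((i : ℕ) + 1)
        ((DHData.ofInput I).M.hullUTheta (DHData.ofInput I).ind3) := by
  refine DHData.not_perPacketReading_of_deep I hp1 v₀ i
    ((stepVConst_lt_of_finrank' I v₀ (by positivity)).trans_le (hdeep.trans ?_))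
  rw [DHData.qPilot_apply_of_mem I hv₀]
  have hj : 0 ≤ (((i : ℕ) + 1 : ℝ) ^ 2) - 1 := by
    have : (1 : ℝ) ≤ ((i : ℕ) + 1 : ℝ) := by
      have : (0 : ℝ) ≤ ((i : ℕ) : ℝ) := Nat.cast_nonneg _
      linarith
    nlinarith
  have hq : 0 ≤ (I.X.ordq v₀.1 : ℝ) / (2 * I.X.l) := by
    have := I.X.ordq_pos hv₀
    positivity
  have hlog : Real.log p ≤ logNorm F₀ v₀.1 := by
    rw [logNorm_eq, (mem_placesOver_iff_residueChar v₀.1).mp v₀.2]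
    have h1 : (1 : ℝ) ≤ resDeg F₀ v₀.1 := by exact_mod_cast Nat.one_le_iff_ne_zero.mpr (resDeg_ne_zero F₀ v₀.1)
    have hp : 0 ≤ Real.log p := Real.log_natCast_nonneg p
    nlinarith
  have : (I.X.ordq v₀.1 : ℝ) / (2 * I.X.l) * Real.log p / Module.finrank ℚ F₀ ≤
      (I.X.ordq v₀.1 : ℝ) / (2 * I.X.l) * logNorm F₀ v₀.1 / Module.finrank ℚ F₀ := by
    gcongr
  exact mul_le_mul_of_nonneg_left this hj

/-- Real core of the top-degree threshold: `m ≥ 2`, `X, L ≥ 0`, `10X + 4L ≤ Q ⟹ (m+1)·X + L ≤ (m² − 1)·Q/(2(2m+1))`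
(`(m−2)(m+1) ≥ 0`, `4m² − 4m − 6 ≥ 0`). [folklore] -/
theorem threshold_top_aux {m X L Q : ℝ} (hm : 2 ≤ m) (hX : 0 ≤ X) (hL : 0 ≤ L) (h : 10 * X + 4 * L ≤ Q) :
    (m + 1) * X + L ≤ (m ^ 2 - 1) * (Q / (2 * (2 * m + 1))) := by
  have hm0 : 0 < 2 * (2 * m + 1) := by linarith
  have hX1 := mul_nonneg hX (show 0 ≤ 6 * m ^ 2 - 6 * m - 12 by nlinarith)
  have hL1 := mul_nonneg hL (show 0 ≤ 4 * m ^ 2 - 4 * m - 6 by nlinarith)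
  have key : (m + 1) * X + L ≤ (m ^ 2 - 1) * ((10 * X + 4 * L) / (2 * (2 * m + 1))) := by
    rw [mul_div_assoc', le_div_iff₀ hm0]
    nlinarith [hX1, hL1]
  exact key.trans (mul_le_mul_of_nonneg_left (div_le_div_of_nonneg_right h hm0.le) (by nlinarith))

/-- The top index `ℓ⋆ − 1 : Fin ℓ⋆` (degree `j = ℓ⋆`). [cite: DupuyHilado2025, §3.3] -/
theorem lstar_sub_one_lt (X : PilotData F₀) : X.lstar - 1 < X.lstar := by
  have := X.two_le_lstar
  omega

/-- **R0 FAILS AT THE TOP PACKET `(ℓ⋆, p)` — clean threshold** (any genuine input, ONE place `v₀ ∈ S` of `F₀` over `p`;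
skeleton §3's instance `j = ℓ⋆`): `10·(log p + 2·log[K:ℚ] + 3) + 4·log p ≤ ord_{v₀}(q)·log p/[F₀:ℚ]` suffices for every
`l ≥ 5` — `l`-FREE, LOGARITHMIC in `[K:ℚ]`. [cite: Mochizuki2012, IUTchIV Thm. 1.10 Step (v) p. 27–28]
[cite: DupuyHilado2025, Def. 3.6.3, Thm. 3.10.1] [claim: Mochizuki2012, status: disputed] -/
theorem not_perPacketReading_top_of_ordq_log_ge (I : Literature.IUT.LogVolume.ThetaVolumeInput F₀ K) {p : ℕ}
    [hpi : Fact p.Prime] (hp1 : ∀ v w : placesOver F₀ p, v = w) (v₀ : placesOver F₀ p) (hv₀ : v₀.1 ∈ I.X.S)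
    (hdeep : 10 * (Real.log p + 2 * Real.log (Module.finrank ℚ K) + 3) + 4 * Real.log p ≤
      (I.X.ordq v₀.1 : ℝ) * Real.log p / Module.finrank ℚ F₀) :
    ¬ (DHData.ofInput I).M.lnνTensorPower p ((I.X.lstar - 1 : ℕ) + 1)
        ((DHData.ofInput I).M.region (DHData.ofInput I).tq) ≤
      (DHData.ofInput I).M.lnνTensorPower p ((I.X.lstar - 1 : ℕ) + 1)
        ((DHData.ofInput I).M.hullUTheta (DHData.ofInput I).ind3) := by
  have h := not_perPacketReading_of_ordq_large_finrank I hp1 v₀ hv₀ ⟨I.X.lstar - 1, lstar_sub_one_lt I.X⟩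
  refine h ?_
  show (((I.X.lstar - 1 : ℕ) : ℝ) + 2) * (Real.log p + 2 * Real.log (Module.finrank ℚ K) + 3) + Real.log p ≤
      ((((I.X.lstar - 1 : ℕ) : ℝ) + 1) ^ 2 - 1) *
        ((I.X.ordq v₀.1 : ℝ) / (2 * I.X.l) * Real.log p / Module.finrank ℚ F₀)
  have h2 := I.X.two_le_lstar
  have hm : (2 : ℝ) ≤ I.X.lstar := by exact_mod_cast h2
  have hcast : ((I.X.lstar - 1 : ℕ) : ℝ) = (I.X.lstar : ℝ) - 1 := by
    rw [Nat.cast_sub (by omega), Nat.cast_one]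
  have hlogp : 0 ≤ Real.log p := Real.log_natCast_nonneg p
  have hN : 0 ≤ Real.log (Module.finrank ℚ K) := Real.log_natCast_nonneg _
  have haux := threshold_top_aux hm (by positivity : 0 ≤ Real.log p + 2 * Real.log (Module.finrank ℚ K) + 3)
    hlogp hdeep
  rw [hcast, I.X.l_cast]
  have e1 : ((I.X.lstar : ℝ) - 1 + 2) * (Real.log p + 2 * Real.log (Module.finrank ℚ K) + 3) + Real.log p =
      ((I.X.lstar : ℝ) + 1) * (Real.log p + 2 * Real.log (Module.finrank ℚ K) + 3) + Real.log p := by ring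
  have e2 : (((I.X.lstar : ℝ) - 1 + 1) ^ 2 - 1) *
        ((I.X.ordq v₀.1 : ℝ) / (2 * (2 * (I.X.lstar : ℝ) + 1)) * Real.log p / Module.finrank ℚ F₀) =
      ((I.X.lstar : ℝ) ^ 2 - 1) *
        ((I.X.ordq v₀.1 : ℝ) * Real.log p / Module.finrank ℚ F₀ / (2 * (2 * (I.X.lstar : ℝ) + 1))) := by ring
  rw [e1, e2]
  exact haux

end ThetaVolumeInput

/-! ## §2 Initial Θ-data ([IUTchI] Def. 3.1): R0 at the packet `(j, p)` for the genuine input OF `D` -/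

namespace InitialThetaData

variable {F K Fbar : Type} [Field F] [NumberField F] [Field K] [NumberField K] [Algebra F K]
  [Field Fbar] [Algebra F Fbar] [Algebra K Fbar] {E : WeierstrassCurve F} [E.IsElliptic] {l : ℕ}
  {Pb : BadPlacePredicates K} (D : Literature.IUT.HodgeTheaters.InitialThetaData F K Fbar E l Pb)

/-- **INITIAL Θ-DATA, every degree `j = i+1 ≥ 2`**: for initial Θ-data `D`, EVERY idele datum `r`, a prime `p` under ONE place
`v₀ ∈ V^bad_mod` of `F_mod`, and a degree `j ≤ ℓ⋆`: `(j+1)·(log p + 2·log[K:ℚ] + 3) + log p ≤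
(j² − 1)·(ord_{v₀}(q)/(2l))·log p/[F_mod:ℚ]` ⟹ the per-packet reading R0 at `(j, p)` is FALSE for the Dupuy–Hilado datum
`DHData.ofInput (volumeInputOf D r)`. [cite: Mochizuki2012, IUTchI Def. 3.1 p. 61–62]
[cite: Mochizuki2012, IUTchIV Thm. 1.10 Step (v) p. 27–28] [claim: Mochizuki2012, status: disputed] -/
theorem not_perPacketReading_volumeInputOf_of_ordq_large_finrank (r : ThetaData.IdeleData D) {p : ℕ}
    [hpi : Fact p.Prime] (hp1 : ∀ v w : placesOver (fieldOfModuli E) p, v = w)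
    (v₀ : placesOver (fieldOfModuli E) p) (hv₀ : v₀.1 ∈ ThetaData.badPrimesMod D) (i : Fin (ThetaData.pilotData D).lstar)
    (hdeep : (((i : ℕ) : ℝ) + 2) * (Real.log p + 2 * Real.log (Module.finrank ℚ K) + 3) + Real.log p ≤
      ((((i : ℕ) + 1 : ℝ) ^ 2) - 1) *
        (((ThetaData.pilotData D).ordq v₀.1 : ℝ) / (2 * l) * Real.log p / Module.finrank ℚ (fieldOfModuli E))) :
    ¬ (DHData.ofInput (ThetaData.volumeInputOf D r)).M.lnνTensorPower p ((i : ℕ) + 1)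
          ((DHData.ofInput (ThetaData.volumeInputOf D r)).M.region
            (DHData.ofInput (ThetaData.volumeInputOf D r)).tq) ≤
        (DHData.ofInput (ThetaData.volumeInputOf D r)).M.lnνTensorPower p ((i : ℕ) + 1)
          ((DHData.ofInput (ThetaData.volumeInputOf D r)).M.hullUTheta
            (DHData.ofInput (ThetaData.volumeInputOf D r)).ind3) :=
  ThetaVolumeInput.not_perPacketReading_of_ordq_large_finrank (ThetaData.volumeInputOf D r) hp1 v₀ hv₀ i hdeep

/-- **INITIAL Θ-DATA, TOP PACKET `(ℓ⋆, p)`, clean threshold**: ONE place `v₀ ∈ V^bad_mod` of `F_mod` over `p` and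
`10·(log p + 2·log[K:ℚ] + 3) + 4·log p ≤ ord_{v₀}(q)·log p/[F_mod:ℚ]` kill R0 at the top packet for `volumeInputOf D r`,
EVERY `r`. [cite: Mochizuki2012, IUTchI Def. 3.1 p. 61–62] [cite: Mochizuki2012, IUTchIV Thm. 1.10 Step (v) p. 27–28]
[claim: Mochizuki2012, status: disputed] -/
theorem not_perPacketReading_top_volumeInputOf_of_ordq_log_ge (r : ThetaData.IdeleData D) {p : ℕ} [hpi : Fact p.Prime]
    (hp1 : ∀ v w : placesOver (fieldOfModuli E) p, v = w) (v₀ : placesOver (fieldOfModuli E) p)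
    (hv₀ : v₀.1 ∈ ThetaData.badPrimesMod D)
    (hdeep : 10 * (Real.log p + 2 * Real.log (Module.finrank ℚ K) + 3) + 4 * Real.log p ≤
      ((ThetaData.pilotData D).ordq v₀.1 : ℝ) * Real.log p / Module.finrank ℚ (fieldOfModuli E)) :
    ¬ (DHData.ofInput (ThetaData.volumeInputOf D r)).M.lnνTensorPower p (((ThetaData.pilotData D).lstar - 1 : ℕ) + 1)
          ((DHData.ofInput (ThetaData.volumeInputOf D r)).M.region
            (DHData.ofInput (ThetaData.volumeInputOf D r)).tq) ≤
        (DHData.ofInput (ThetaData.volumeInputOf D r)).M.lnνTensorPower p (((ThetaData.pilotData D).lstar - 1 : ℕ) + 1)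
          ((DHData.ofInput (ThetaData.volumeInputOf D r)).M.hullUTheta
            (DHData.ofInput (ThetaData.volumeInputOf D r)).ind3) :=
  ThetaVolumeInput.not_perPacketReading_top_of_ordq_log_ge (ThetaData.volumeInputOf D r) hp1 v₀ hv₀ hdeep

/-- **INITIAL Θ-DATA with `j_E ∈ ℚ`, TOP PACKET**: ONE bad prime `p` (under `v₀ ∈ V^bad_mod`) of local height
`ord_p(q)·log p ≥ 14·log p + 20·log[K:ℚ] + 30` kills R0 — hence R2/R3/R4/VolumeTransport (skeleton XXIV) — at the packet
`(ℓ⋆, p)` for `DHData.ofInput (volumeInputOf D r)`, EVERY idele datum `r`. [cite: Mochizuki2012, IUTchI Def. 3.1 p. 61–62]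
[cite: Mochizuki2012, IUTchIV Thm. 1.10 Step (v) p. 27–28] [claim: Mochizuki2012, status: disputed] -/
theorem not_perPacketReading_top_volumeInputOf_of_j_mem_range (hj : E.j ∈ Set.range (algebraMap ℚ F))
    (r : ThetaData.IdeleData D) {p : ℕ} [hpi : Fact p.Prime] (v₀ : placesOver (fieldOfModuli E) p)
    (hv₀ : v₀.1 ∈ ThetaData.badPrimesMod D)
    (hdeep : 14 * Real.log p + 20 * Real.log (Module.finrank ℚ K) + 30 ≤
      ((ThetaData.pilotData D).ordq v₀.1 : ℝ) * Real.log p) :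
    ¬ (DHData.ofInput (ThetaData.volumeInputOf D r)).M.lnνTensorPower p (((ThetaData.pilotData D).lstar - 1 : ℕ) + 1)
          ((DHData.ofInput (ThetaData.volumeInputOf D r)).M.region
            (DHData.ofInput (ThetaData.volumeInputOf D r)).tq) ≤
        (DHData.ofInput (ThetaData.volumeInputOf D r)).M.lnνTensorPower p (((ThetaData.pilotData D).lstar - 1 : ℕ) + 1)
          ((DHData.ofInput (ThetaData.volumeInputOf D r)).M.hullUTheta
            (DHData.ofInput (ThetaData.volumeInputOf D r)).ind3) := by
  have hd : Module.finrank ℚ (fieldOfModuli E) = 1 := finrank_fieldOfModuli_eq_one_of_j_mem_range hj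
  refine not_perPacketReading_top_volumeInputOf_of_ordq_log_ge D r
    (ValLine.placesOver_subsingleton_of_finrank_eq_one hd p) v₀ hv₀ ?_
  rw [hd, Nat.cast_one, div_one]
  linarith

end InitialThetaData

end Summit.ABC.IUTFork

end
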